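import Literature.Computability.Complexity.IntVectorBricks
import Literature.Computability.Complexity.ZIntBricks
import HarnessLib

/-!
# Integer matrix bricks in the `FP` algebra, I: tests, format conversion, offset dot products, difference-pair row and matrix loops

Toolkit continuing `IntPairBricks.lean` (difference pairs `ival`, `iaddFn`, `imulFn`, `iposFn`,
`ofSMFn`) and `IntVectorBricks.lean` (list codes `body`, index access `elemOf`, the loops
`rowLoopFn`/`matLoopFn`/`sqLoopFn` for ONE matrix given in the sign–magnitude input format). A
verifier of an integer certificate (the coNP verifiers of `Algebra/EuclideanLattices/
GapCVPCoNPWitness.lean` and `ARVerifier.lean`: products `C B`, `B Bᵀ`, `AᵀA`, `RᵀR`, phases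
`aⱼ · (t C)`, comparisons) computes with SEVERAL matrices, all held as difference pairs once the
input has been converted. This file supplies the difference-pair-only layer:

* one-bit tests `isZeroFn u = [ival u = 0]` (with the negation `zswapF` of `ZIntBricks.lean`), and the magnitude
  `inatAbsFn u = encodeNat |ival u|`;
* `smToDpLoopFn` — conversion of a list of sign–magnitude codes (read by index from the fixed
  field) into the list code of difference pairs (`smToDpLoopFn_spec`, values `ival = smval`);
* `dotOffLoopFn` — the dot product `∑_{l<n} ival u[p + l] · ival v[q + l]` of two windows of two
  lists read by index with independent unary offsets (rows `i`, `k` of one flat row-major matrix: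
  the entries of `B Bᵀ`), `dotOffLoopFn_spec`, `ival_dotAcc`;
* `rowLoopDPFn`, `matLoopDPFn` — the row and matrix loops of `IntVectorBricks.lean` with the matrix
  ALSO in difference pairs (`z C` for a certificate matrix `C`), same queue discipline, same specs
  (`rowLoopDPFn_spec`, `matLoopDPFn_spec`, `ival_matAccDP`). (Refactor note, librarian: these are
  the `IntVectorBricks` proofs with the entry reader `ofSMFn ∘` removed; both instances should later
  be derived from one loop parametrised by an `FP` entry reader with a linear length bound.)

All loops read data by index from their fixed first field (growth linear in it on every record) and
keep accumulators in the last record slot, so they are in `FP` by `loopFn_mem_FP` /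
`loopFn_mem_FP_of_poly` and nest freely; all value specifications are total in the list arguments.

## References

* S. Arora, B. Barak, *Computational Complexity: A Modern Approach*, CUP 2009, §1.3.
* D. E. Knuth, *The Art of Computer Programming*, Vol. 2, 3rd ed., 1998, §4.3.1, §4.6.4.
-/

namespace Literature.Computability.Complexity

open _root_.Computability OracleCompose PRelSigPi Polynomial

namespace Brick

/-! ### Zero test and magnitude of a difference pair -/

/-- **Zero test** `isZeroFn u = [decide (ival u = 0)]` (neither `u` nor `-u` is positive).
[folklore] -/
noncomputable def isZeroFn : List Bool → List Bool := andFn (notFn iposFn) (notFn (iposFn ∘ zswapF))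

/-- `isZeroFn ∈ FP`. [cite: AroraBarakCC2009, §1.3] -/
theorem isZeroFn_mem_FP : isZeroFn ∈ FP :=
  andFn_mem_FP (notFn_mem_FP iposFn_mem_FP) (notFn_mem_FP (comp_mem_FP iposFn_mem_FP zswapF_mem_FP))

/-- Value of `isZeroFn` on every string. [folklore] -/
@[simp] theorem isZeroFn_apply (u : List Bool) : isZeroFn u = [decide (ival u = 0)] := by
  rw [isZeroFn, andFn_apply (b := !decide (0 < ival u)) (b' := !decide (0 < -ival u))]
  · congr 1
    by_cases h : ival u = 0
    · simp [h]
    · rcases lt_or_gt_of_ne h with hl | hg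
      · simp [h, hl.not_gt, hl]
      · simp [h, hg]
  · rw [notFn_apply (b := decide (0 < ival u)) (iposFn_apply u)]
  · rw [notFn_apply (b := decide (0 < -ival u))]
    simp [Function.comp_apply]

/-- `isZeroFn` is one-bit. [folklore] -/
theorem oneBit_isZeroFn : OneBit isZeroFn := fun u => ⟨_, isZeroFn_apply u⟩

/-- **Magnitude** `inatAbsFn u = encodeNat |ival u|` (a canonical numeral). [folklore] -/
noncomputable def inatAbsFn : List Bool → List Bool :=
  iteFn iposFn (subFn ∘ fanoutFn fstF sndF) (subFn ∘ fanoutFn sndF fstF)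

/-- `inatAbsFn ∈ FP`. [cite: AroraBarakCC2009, §1.3] -/
theorem inatAbsFn_mem_FP : inatAbsFn ∈ FP :=
  iteFn_mem_FP iposFn_mem_FP (comp_mem_FP subFn_mem_FP (fanoutFn_mem_FP fstF_mem_FP sndF_mem_FP))
    (comp_mem_FP subFn_mem_FP (fanoutFn_mem_FP sndF_mem_FP fstF_mem_FP))

/-- Value of `inatAbsFn` on every string. [folklore] -/
@[simp] theorem inatAbsFn_apply (u : List Bool) : inatAbsFn u = encodeNat (ival u).natAbs := by
  rw [inatAbsFn, iteFn_of_oneBit oneBit_iposFn, iposFn_apply]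
  by_cases h : 0 < ival u
  · rw [if_pos (by simp [h])]
    simp only [Function.comp_apply, fanoutFn_apply, subFn_boolPair]
    congr 1
    unfold ival at h ⊢
    omega
  · rw [if_neg (by simp [h])]
    simp only [Function.comp_apply, fanoutFn_apply, subFn_boolPair]
    congr 1
    unfold ival at h ⊢
    omega

/-- `|inatAbsFn u| ≤ |u|`. [folklore] -/
theorem length_inatAbsFn_le (u : List Bool) : (inatAbsFn u).length ≤ u.length := by
  have h := length_fstF_sndF_le u
  rw [inatAbsFn, iteFn_of_oneBit oneBit_iposFn]
  split_ifs
  · simp only [Function.comp_apply, fanoutFn_apply, subFn_boolPair]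
    exact (length_encodeNat_mono (Nat.sub_le _ _)).trans ((length_encodeNat_bitsToNat_le _).trans (by omega))
  · simp only [Function.comp_apply, fanoutFn_apply, subFn_boolPair]
    exact (length_encodeNat_mono (Nat.sub_le _ _)).trans ((length_encodeNat_bitsToNat_le _).trans (by omega))

/-! ### Conversion of a sign–magnitude list to difference pairs -/

/-- **The conversion round** on `⟨src, ⟨cnt, ⟨ku, out⟩⟩⟩`:
`⟨ku, out⟩ ↦ ⟨1 · ku, out ++ ⟨ofSM(src[|ku|]), []⟩⟩`. [folklore] -/
noncomputable def smToDpBody : List Bool → List Bool :=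
  fanoutFn (List.cons true ∘ nthF 2)
    (appendFn ∘ fanoutFn (sndPow 2) (fanoutFn (ofSMFn ∘ elemFn ∘ fanoutFn (nthF 2) (nthF 0)) fun _ => []))

/-- `smToDpBody ∈ FP`. [cite: AroraBarakCC2009, §1.3] -/
theorem smToDpBody_mem_FP : smToDpBody ∈ FP :=
  fanoutFn_mem_FP (comp_mem_FP (cons_mem_FP true) (nthF_mem_FP 2))
    (comp_mem_FP appendFn_mem_FP (fanoutFn_mem_FP (sndPow_mem_FP 2)
      (fanoutFn_mem_FP (comp_mem_FP ofSMFn_mem_FP (comp_mem_FP elemFn_mem_FP (fanoutFn_mem_FP (nthF_mem_FP 2) (nthF_mem_FP 0))))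
        (const_mem_FP _))))

/-- The state map of the conversion loop. [folklore] -/
noncomputable def smToDpStep (src : List Bool) (s : List Bool) : List Bool :=
  boolPair (true :: fstP s) (sndP s ++ boolPair (ofSMFn (elemOf src (fstP s).length)) [])

/-- The conversion round on a record is the state map. [folklore] -/
theorem smToDpBody_apply (src cnt s : List Bool) : smToDpBody (boolPair src (boolPair cnt s)) = smToDpStep src s := by
  simp [smToDpBody, smToDpStep, nthF, sndPow, fstF, sndF, elemFn_boolPair, fstP, sndP]

/-- Growth of a conversion round is linear in the fixed field, on every record. [folklore] -/
theorem length_smToDpBody_le (z : List Bool) : (smToDpBody z).length ≤ (sndPow 1 z).length + 12 * ((fstF z).length + 1) := by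
  have hku : nthF 2 z = fstF (sndPow 1 z) := by simp [nthF, sndPow, fstF, sndF]
  have hq : sndPow 2 z = sndF (sndPow 1 z) := by simp [sndPow]
  have hst := length_fstF_sndF_le (sndPow 1 z)
  have he : (elemOf (fstF z) (fstF (sndPow 1 z)).length).length ≤ (fstF z).length := length_elemOf_le _ _
  have he' := length_ofSMFn_le (elemOf (fstF z) (fstF (sndPow 1 z)).length)
  have hbody : smToDpBody z = boolPair (true :: fstF (sndPow 1 z))
      (sndF (sndPow 1 z) ++ boolPair (ofSMFn (elemOf (fstF z) (fstF (sndPow 1 z)).length)) []) := by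
    simp only [smToDpBody, fanoutFn_apply, Function.comp_apply, appendFn_boolPair, hku, hq, elemFn_boolPair]
    rfl
  rw [hbody, length_boolPair, List.length_append, length_boolPair, List.length_cons, List.length_nil]
  omega

/-- **The conversion loop**: `|src|` rounds. [folklore] -/
noncomputable def smToDpLoopFn (z : List Bool) : List Bool := (loopStep smToDpBody)^[X.eval (fstF z).length] z

/-- `smToDpLoopFn ∈ FP`. [cite: AroraBarakCC2009, §1.3] -/
theorem smToDpLoopFn_mem_FP : smToDpLoopFn ∈ FP :=
  loopFn_mem_FP smToDpBody_mem_FP (c := 12) length_smToDpBody_le X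

/-- The converted list: `[ofSM(src[0]), …, ofSM(src[k-1])]`. [folklore] -/
noncomputable def smToDpList (src : List Bool) (k : ℕ) : List (List Bool) :=
  List.ofFn fun i : Fin k => ofSMFn (elemOf src i)

/-- Length of the converted list. [folklore] -/
@[simp] theorem length_smToDpList (src : List Bool) (k : ℕ) : (smToDpList src k).length = k := by simp [smToDpList]

/-- **Values of the converted list**: `ival (out[i]) = smval (src[i])`. [folklore] -/
theorem ival_elemOf_smToDpList (src : List Bool) {k i : ℕ} (hi : i < k) :
    ival (elemOf (body (smToDpList src k)) i) = smval (elemOf src i) := by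
  rw [elemOf_body_of_lt _ (by simpa using hi)]
  simp [smToDpList]

/-- The conversion invariant. [folklore] -/
theorem iterate_smToDpStep (src : List Bool) :
    ∀ k : ℕ, (smToDpStep src)^[k] (boolPair [] []) = boolPair (List.replicate k true) (body (smToDpList src k))
  | 0 => by simp [smToDpList]
  | k + 1 => by
    rw [Function.iterate_succ_apply', iterate_smToDpStep src k, smToDpStep, fstP_boolPair, sndP_boolPair,
      List.length_replicate, ← body_singleton, ← body_append]
    congr 1
    simp only [smToDpList, List.ofFn_succ', List.concat_eq_append, Fin.val_castSucc, Fin.val_last]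

/-- **Specification of the conversion loop**: from `⟨src, ⟨k, ⟨1⁰, ε⟩⟩⟩` with `k ≤ |src|`, the loop
ends with the list code of the `k` converted entries. [folklore] -/
theorem smToDpLoopFn_spec (src : List Bool) (k : ℕ) (hk : k ≤ src.length) :
    smToDpLoopFn (boolPair src (boolPair (encodeNat k) (boolPair [] []))) =
      boolPair src (boolPair [] (boolPair (List.replicate k true) (body (smToDpList src k)))) := by
  have hx : fstF (boolPair src (boolPair (encodeNat k) (boolPair [] []))) = src := by simp [fstF]
  rw [smToDpLoopFn, hx, eval_X, iterate_loopStep smToDpBody _ k _ _ hk,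
    loopModel_eq_iterate (g := smToDpStep src) (fun cnt s => smToDpBody_apply src cnt s), iterate_smToDpStep src k]

/-! ### Dot product of two windows read by index with offsets -/

/-- The record of the offset dot product is `⟨⟨u, v⟩, ⟨cnt, ⟨ku, ⟨kv, S⟩⟩⟩⟩`; the round reads
`u[|ku|]`, `v[|kv|]`. [cite: KnuthTAOCP2, §4.6.4] -/
noncomputable def dotOffBody : List Bool → List Bool :=
  fanoutFn (List.cons true ∘ nthF 2)
    (fanoutFn (List.cons true ∘ nthF 3)
      (iaddFn ∘ fanoutFn (sndPow 3)
        (imulFn ∘ fanoutFn (elemFn ∘ fanoutFn (nthF 2) (fstF ∘ nthF 0)) (elemFn ∘ fanoutFn (nthF 3) (sndF ∘ nthF 0)))))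

/-- `dotOffBody ∈ FP`. [cite: AroraBarakCC2009, §1.3] -/
theorem dotOffBody_mem_FP : dotOffBody ∈ FP :=
  fanoutFn_mem_FP (comp_mem_FP (cons_mem_FP true) (nthF_mem_FP 2))
    (fanoutFn_mem_FP (comp_mem_FP (cons_mem_FP true) (nthF_mem_FP 3))
      (comp_mem_FP iaddFn_mem_FP (fanoutFn_mem_FP (sndPow_mem_FP 3)
        (comp_mem_FP imulFn_mem_FP (fanoutFn_mem_FP
          (comp_mem_FP elemFn_mem_FP (fanoutFn_mem_FP (nthF_mem_FP 2) (comp_mem_FP fstF_mem_FP (nthF_mem_FP 0))))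
          (comp_mem_FP elemFn_mem_FP (fanoutFn_mem_FP (nthF_mem_FP 3) (comp_mem_FP sndF_mem_FP (nthF_mem_FP 0)))))))))

/-- The state map of the offset dot product for fixed `u`, `v`. [folklore] -/
noncomputable def dotOffStep (u v : List Bool) (s : List Bool) : List Bool :=
  boolPair (true :: fstP s) (boolPair (true :: fstP (sndP s))
    (iaddFn (boolPair (sndP (sndP s)) (imulFn (boolPair (elemOf u (fstP s).length) (elemOf v (fstP (sndP s)).length))))))

/-- The round on a record is the state map. [folklore] -/
theorem dotOffBody_apply (u v cnt s : List Bool) : dotOffBody (boolPair (boolPair u v) (boolPair cnt s)) = dotOffStep u v s := by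
  simp [dotOffBody, dotOffStep, nthF, sndPow, fstF, sndF, elemFn_boolPair, fstP, sndP]

/-- Growth of a round is linear in the fixed field, on every record. [folklore] -/
theorem length_dotOffBody_le (z : List Bool) : (dotOffBody z).length ≤ (sndPow 1 z).length + 20 * ((fstF z).length + 1) := by
  have hku : nthF 2 z = fstF (sndPow 1 z) := by simp [nthF, sndPow, fstF, sndF]
  have hkv : nthF 3 z = fstF (sndF (sndPow 1 z)) := by simp [nthF, sndPow, fstF, sndF]
  have hS : sndPow 3 z = sndF (sndF (sndPow 1 z)) := by simp [sndPow]
  have hst := length_fstF_sndF_le (sndPow 1 z)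
  have hst2 := length_fstF_sndF_le (sndF (sndPow 1 z))
  have hx := length_fstF_sndF_le (fstF z)
  set a := elemOf (fstF (fstF z)) (fstF (sndPow 1 z)).length
  set b := elemOf (sndF (fstF z)) (fstF (sndF (sndPow 1 z))).length
  have ha : a.length ≤ (fstF (fstF z)).length := length_elemOf_le _ _
  have hb : b.length ≤ (sndF (fstF z)).length := length_elemOf_le _ _
  have hmul := length_imulFn_boolPair_le a b
  have hadd := length_iaddFn_boolPair_le (sndF (sndF (sndPow 1 z))) (imulFn (boolPair a b))
  have hbody : dotOffBody z = boolPair (true :: fstF (sndPow 1 z)) (boolPair (true :: fstF (sndF (sndPow 1 z)))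
      (iaddFn (boolPair (sndF (sndF (sndPow 1 z))) (imulFn (boolPair a b))))) := by
    simp only [dotOffBody, fanoutFn_apply, Function.comp_apply, hku, hkv, hS, elemFn_boolPair]
    rfl
  rw [hbody, length_boolPair, length_boolPair, List.length_cons, List.length_cons]
  omega

/-- **The offset dot-product loop**: `|⟨u, v⟩|` rounds. [cite: KnuthTAOCP2, §4.6.4] -/
noncomputable def dotOffLoopFn (z : List Bool) : List Bool := (loopStep dotOffBody)^[X.eval (fstF z).length] z

/-- `dotOffLoopFn ∈ FP`. [cite: AroraBarakCC2009, §1.3] -/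
theorem dotOffLoopFn_mem_FP : dotOffLoopFn ∈ FP :=
  loopFn_mem_FP dotOffBody_mem_FP (c := 20) length_dotOffBody_le X

/-- The accumulated dot product after `l` rounds from offsets `p`, `q`, as a string: `D₀ = ε`,
`D_{l+1} = D_l + u[p+l] · v[q+l]`. [folklore] -/
noncomputable def dotAcc (u v : List Bool) (p q : ℕ) : ℕ → List Bool
  | 0 => []
  | l + 1 => iaddFn (boolPair (dotAcc u v p q l) (imulFn (boolPair (elemOf u (p + l)) (elemOf v (q + l)))))

/-- **Value of the accumulated dot product**: `ival D_l = ∑_{t<l} ival u[p+t] · ival v[q+t]`.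
[cite: KnuthTAOCP2, §4.6.4] -/
theorem ival_dotAcc (u v : List Bool) (p q : ℕ) :
    ∀ l : ℕ, ival (dotAcc u v p q l) = ∑ t ∈ Finset.range l, ival (elemOf u (p + t)) * ival (elemOf v (q + t))
  | 0 => by simp [dotAcc]
  | l + 1 => by rw [dotAcc, ival_iaddFn_boolPair, ival_imulFn_boolPair, ival_dotAcc u v p q l, Finset.sum_range_succ]

/-- The offset dot-product invariant. [folklore] -/
theorem iterate_dotOffStep (u v : List Bool) (p q : ℕ) :
    ∀ l : ℕ, (dotOffStep u v)^[l] (boolPair (List.replicate p true) (boolPair (List.replicate q true) [])) =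
      boolPair (List.replicate (p + l) true) (boolPair (List.replicate (q + l) true) (dotAcc u v p q l))
  | 0 => rfl
  | l + 1 => by
    rw [Function.iterate_succ_apply', iterate_dotOffStep u v p q l, dotOffStep, fstP_boolPair, sndP_boolPair, fstP_boolPair,
      sndP_boolPair, List.length_replicate, List.length_replicate]
    rw [show p + (l + 1) = (p + l) + 1 by omega, show q + (l + 1) = (q + l) + 1 by omega, List.replicate_succ, List.replicate_succ]
    rfl

/-- **Specification of the offset dot-product loop**: from `⟨⟨u, v⟩, ⟨n, ⟨1ᵖ, ⟨1^q, ε⟩⟩⟩⟩` with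
`n ≤ |⟨u, v⟩|`, the loop ends with offsets advanced by `n` and the accumulated dot product `D_n`.
[cite: KnuthTAOCP2, §4.6.4] -/
theorem dotOffLoopFn_spec (u v : List Bool) (n p q : ℕ) (hn : n ≤ (boolPair u v).length) :
    dotOffLoopFn (boolPair (boolPair u v) (boolPair (encodeNat n)
        (boolPair (List.replicate p true) (boolPair (List.replicate q true) [])))) =
      boolPair (boolPair u v) (boolPair []
        (boolPair (List.replicate (p + n) true) (boolPair (List.replicate (q + n) true) (dotAcc u v p q n)))) := by
  have hx : fstF (boolPair (boolPair u v) (boolPair (encodeNat n)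
      (boolPair (List.replicate p true) (boolPair (List.replicate q true) [])))) = boolPair u v := by simp [fstF]
  rw [dotOffLoopFn, hx, eval_X, iterate_loopStep dotOffBody _ n _ _ hn,
    loopModel_eq_iterate (g := dotOffStep u v) (fun cnt s => dotOffBody_apply u v cnt s), iterate_dotOffStep u v p q n]

/-! ### One scaled row and all rows, with the matrix in difference pairs -/


/-- The new entry of a row round, from the record `⟨⟨ents, c⟩, ⟨cnt, ⟨ku, q⟩⟩⟩`:
`front(q) + c · ents[|ku|]`. [cite: KnuthTAOCP2, §4.6.4] -/
noncomputable def rowNewDPFn : List Bool → List Bool :=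
  iaddFn ∘ fanoutFn (fstF ∘ sndPow 2)
    (imulFn ∘ fanoutFn (sndF ∘ nthF 0) (elemFn ∘ fanoutFn (nthF 2) (fstF ∘ nthF 0)))

/-- `rowNewDPFn ∈ FP`. [cite: AroraBarakCC2009, §1.3] -/
theorem rowNewDPFn_mem_FP : rowNewDPFn ∈ FP :=
  comp_mem_FP iaddFn_mem_FP (fanoutFn_mem_FP (comp_mem_FP fstF_mem_FP (sndPow_mem_FP 2))
    (comp_mem_FP imulFn_mem_FP (fanoutFn_mem_FP (comp_mem_FP sndF_mem_FP (nthF_mem_FP 0))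
      (comp_mem_FP elemFn_mem_FP (fanoutFn_mem_FP (nthF_mem_FP 2)
        (comp_mem_FP fstF_mem_FP (nthF_mem_FP 0)))))))

/-- Value of `rowNewDPFn` on a record. [folklore] -/
theorem rowNewDPFn_apply (ents c cnt ku q : List Bool) :
    rowNewDPFn (boolPair (boolPair ents c) (boolPair cnt (boolPair ku q))) =
      iaddFn (boolPair (fstP q) (imulFn (boolPair c ((elemOf ents ku.length))))) := by
  simp [rowNewDPFn, nthF, sndPow, fstF, sndF, elemFn_boolPair, fstP]

/-- **The row round**: `⟨ku, q⟩ ↦ ⟨1 · ku, tail(q) ++ ⟨new, []⟩⟩` — advance the index, pop the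
front accumulator, append the updated one at the back. [cite: KnuthTAOCP2, §4.6.4] -/
noncomputable def rowBodyDP : List Bool → List Bool :=
  fanoutFn (List.cons true ∘ nthF 2) (appendFn ∘ fanoutFn (sndF ∘ sndPow 2) (fanoutFn rowNewDPFn fun _ => []))

/-- `rowBodyDP ∈ FP`. [cite: AroraBarakCC2009, §1.3] -/
theorem rowBodyDP_mem_FP : rowBodyDP ∈ FP :=
  fanoutFn_mem_FP (comp_mem_FP (cons_mem_FP true) (nthF_mem_FP 2))
    (comp_mem_FP appendFn_mem_FP (fanoutFn_mem_FP (comp_mem_FP sndF_mem_FP (sndPow_mem_FP 2))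
      (fanoutFn_mem_FP rowNewDPFn_mem_FP (const_mem_FP _))))

/-- The state map of the row loop for fixed `ents`, `c`. [folklore] -/
noncomputable def rowStepDP (ents c : List Bool) (s : List Bool) : List Bool :=
  boolPair (true :: fstP s)
    (sndP (sndP s) ++ boolPair (iaddFn (boolPair (fstP (sndP s)) (imulFn (boolPair c ((elemOf ents (fstP s).length)))))) [])

/-- The row round on a record is the state map (the counter is ignored). [folklore] -/
theorem rowBodyDP_apply (ents c cnt s : List Bool) :
    rowBodyDP (boolPair (boolPair ents c) (boolPair cnt s)) = rowStepDP ents c s := by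
  simp only [rowBodyDP, fanoutFn_apply, Function.comp_apply, appendFn_boolPair, rowStepDP]
  congr 1
  · simp [nthF, fstF, sndF, fstP]
  · have h1 : sndF (sndPow 2 (boolPair (boolPair ents c) (boolPair cnt s))) = sndP (sndP s) := by
      simp [sndPow, sndF, sndP]
    have h2 : rowNewDPFn (boolPair (boolPair ents c) (boolPair cnt s)) =
        iaddFn (boolPair (fstP (sndP s)) (imulFn (boolPair c ((elemOf ents (fstP s).length))))) := by
      simp [rowNewDPFn, nthF, sndPow, fstF, sndF, elemFn, nthRest, elemOf, fstP, sndP]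
    rw [h1, h2]

/-- **Growth of a row round is linear in the fixed field, on every record.**
`|rowBodyDP z| ≤ |sndPow 1 z| + 38 (|fstF z| + 1)`. [folklore] -/
theorem length_rowBodyDP_le (z : List Bool) : (rowBodyDP z).length ≤ (sndPow 1 z).length + 38 * ((fstF z).length + 1) := by
  -- the pieces of the record: `x = fstF z`, `s = sndPow 1 z = ⟨ku, q⟩`, `x = ⟨ents, c⟩`
  have hku : nthF 2 z = fstF (sndPow 1 z) := by simp [nthF, sndPow, fstF, sndF]
  have hq : sndPow 2 z = sndF (sndPow 1 z) := by simp [sndPow]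
  have hsplit := length_fstF_sndF_le (sndPow 1 z)
  have hqsplit := length_fstF_sndF_le (sndF (sndPow 1 z))
  have hxsplit := length_fstF_sndF_le (fstF z)
  -- the new entry
  have hnew : rowNewDPFn z = iaddFn (boolPair (fstF (sndF (sndPow 1 z)))
      (imulFn (boolPair (sndF (fstF z)) ((elemOf (fstF (fstF z)) (fstF (sndPow 1 z)).length))))) := by
    simp only [rowNewDPFn, Function.comp_apply, fanoutFn_apply, hku, hq, elemFn_boolPair]
    rfl
  have he : (elemOf (fstF (fstF z)) (fstF (sndPow 1 z)).length).length ≤ (fstF (fstF z)).length := length_elemOf_le _ _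
  have hmul := length_imulFn_boolPair_le (sndF (fstF z)) ((elemOf (fstF (fstF z)) (fstF (sndPow 1 z)).length))
  have hadd := length_iaddFn_boolPair_le (fstF (sndF (sndPow 1 z)))
    (imulFn (boolPair (sndF (fstF z)) ((elemOf (fstF (fstF z)) (fstF (sndPow 1 z)).length))))
  have hbody : rowBodyDP z = boolPair (true :: fstF (sndPow 1 z)) (sndF (sndF (sndPow 1 z)) ++ boolPair (rowNewDPFn z) []) := by
    simp only [rowBodyDP, fanoutFn_apply, Function.comp_apply, appendFn_boolPair, hku, hq]
  rw [hbody, length_boolPair, List.length_append, length_boolPair, hnew, List.length_cons, List.length_nil]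
  omega

/-- **The row loop**: `|⟨ents, c⟩|` rounds of `loopStep rowBodyDP` (at least the counter).
[cite: KnuthTAOCP2, §4.6.4] -/
noncomputable def rowLoopDPFn (z : List Bool) : List Bool := (loopStep rowBodyDP)^[X.eval (fstF z).length] z

/-- **`rowLoopDPFn ∈ FP`** (a counted loop of linear growth). [cite: AroraBarakCC2009, §1.3] -/
theorem rowLoopDPFn_mem_FP : rowLoopDPFn ∈ FP :=
  loopFn_mem_FP rowBodyDP_mem_FP (c := 38) length_rowBodyDP_le X

/-- The new entries of a row: `accⱼ + c · ents[k + j]`, `j < n`, as strings. [folklore] -/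
noncomputable def rowNewsDP (ents c : List Bool) (k : ℕ) (acc : List (List Bool)) (n : ℕ) : List (List Bool) :=
  List.ofFn fun j : Fin n => iaddFn (boolPair (acc.getD j []) (imulFn (boolPair c ((elemOf ents (k + j))))))

/-- Length of `rowNewsDP`. [folklore] -/
@[simp] theorem length_rowNewsDP (ents c : List Bool) (k : ℕ) (acc : List (List Bool)) (n : ℕ) :
    (rowNewsDP ents c k acc n).length = n := by simp [rowNewsDP]

/-- **Values of the new entries**: `ival (acc'ⱼ) = ival accⱼ + ival c · ival ents[k + j]`.
[cite: KnuthTAOCP2, §4.6.4] -/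
theorem ival_rowNewsDP (ents c : List Bool) (k : ℕ) (acc : List (List Bool)) (n : ℕ) (j : ℕ) (hj : j < n) :
    ival ((rowNewsDP ents c k acc n).getD j []) = ival (acc.getD j []) + ival c * ival (elemOf ents (k + j)) := by
  rw [rowNewsDP, List.getD_eq_getElem _ _ (by simpa using hj), List.getElem_ofFn]
  simp

/-- The row invariant: after `j ≤ n` rounds from `⟨1ᵏ, body acc⟩` (`|acc| = n`) the state is
`⟨1ᵏ⁺ʲ, body (acc.drop j ++ news_j)⟩`. [folklore] -/
theorem iterate_rowStepDP (ents c : List Bool) (k : ℕ) (acc : List (List Bool)) :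
    ∀ j : ℕ, j ≤ acc.length →
      (rowStepDP ents c)^[j] (boolPair (List.replicate k true) (body acc)) =
        boolPair (List.replicate (k + j) true) (body (acc.drop j ++ rowNewsDP ents c k acc j))
  | 0, _ => by simp [rowNewsDP]
  | j + 1, hj => by
    rw [Function.iterate_succ_apply', iterate_rowStepDP ents c k acc j (by omega), rowStepDP, fstP_boolPair, sndP_boolPair,
      List.length_replicate]
    have hdrop : acc.drop j = acc.getD j [] :: acc.drop (j + 1) := by
      rw [List.getD_eq_getElem _ _ (by omega)]
      exact (List.getElem_cons_drop (by omega)).symm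
    rw [hdrop, List.cons_append, body_cons, fstP_boolPair, sndP_boolPair]
    congr 1
    rw [← body_singleton, ← body_append, List.append_assoc]
    congr 2
    simp only [rowNewsDP, List.ofFn_succ', List.concat_eq_append, Fin.val_castSucc, Fin.val_last]

/-- **Specification of the row loop**: from `⟨⟨ents, c⟩, ⟨n, ⟨1ᵏ, body acc⟩⟩⟩` with `|acc| = n`
and `n ≤ |⟨ents, c⟩|`, the loop ends with counter `0`, index `1ⁿ⁺ᵏ` and the list code of the
updated row. [cite: KnuthTAOCP2, §4.6.4] -/
theorem rowLoopDPFn_spec (ents c : List Bool) (k : ℕ) (acc : List (List Bool))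
    (hn : acc.length ≤ (boolPair ents c).length) :
    rowLoopDPFn (boolPair (boolPair ents c) (boolPair (encodeNat acc.length) (boolPair (List.replicate k true) (body acc)))) =
      boolPair (boolPair ents c) (boolPair []
        (boolPair (List.replicate (k + acc.length) true) (body (rowNewsDP ents c k acc acc.length)))) := by
  rw [rowLoopDPFn, show fstF (boolPair (boolPair ents c) (boolPair (encodeNat acc.length)
      (boolPair (List.replicate k true) (body acc)))) = boolPair ents c by simp [fstF], eval_X,
    iterate_loopStep rowBodyDP _ acc.length _ _ hn,
    loopModel_eq_iterate (g := rowStepDP ents c) (fun cnt s => rowBodyDP_apply ents c cnt s),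
    iterate_rowStepDP ents c k acc acc.length le_rfl, List.drop_length, List.nil_append]

/-- **Size of the row loop's result** from a general record: `m` rounds add at most
`m · 42 (|x| + 1)`. [folklore] -/
theorem length_iterate_loopStep_rowBodyDP_le (m : ℕ) (z : List Bool) :
    ((loopStep rowBodyDP)^[m] z).length ≤ z.length + m * (42 * ((fstF z).length + 1)) :=
  length_iterate_le_of_growth 42 (fun w => fstF_loopStep rowBodyDP w) (fun w => length_loopStep_le length_rowBodyDP_le w) z m



/-- The record of the matrix loop is `⟨⟨ents, ⟨zs, nc⟩⟩, ⟨cnt, ⟨iu, ⟨ku, acc⟩⟩⟩⟩`; the inner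
record handed to the row loop is `⟨⟨ents, zs[|iu|]⟩, ⟨nc, ⟨ku, acc⟩⟩⟩`. [cite: KnuthTAOCP2, §4.6.4] -/
noncomputable def matSetupDPFn : List Bool → List Bool :=
  fanoutFn (fanoutFn (fstF ∘ nthF 0) (elemFn ∘ fanoutFn (nthF 2) (nthF 1 ∘ nthF 0)))
    (fanoutFn (sndPow 1 ∘ nthF 0) (sndPow 2))

/-- `matSetupDPFn ∈ FP`. [cite: AroraBarakCC2009, §1.3] -/
theorem matSetupDPFn_mem_FP : matSetupDPFn ∈ FP :=
  fanoutFn_mem_FP (fanoutFn_mem_FP (comp_mem_FP fstF_mem_FP (nthF_mem_FP 0))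
      (comp_mem_FP elemFn_mem_FP (fanoutFn_mem_FP (nthF_mem_FP 2) (comp_mem_FP (nthF_mem_FP 1) (nthF_mem_FP 0)))))
    (fanoutFn_mem_FP (comp_mem_FP (sndPow_mem_FP 1) (nthF_mem_FP 0)) (sndPow_mem_FP 2))

/-- Value of `matSetupDPFn` on a record. [folklore] -/
theorem matSetupDPFn_apply (ents zs nc cnt iu t : List Bool) :
    matSetupDPFn (boolPair (boolPair ents (boolPair zs nc)) (boolPair cnt (boolPair iu t))) =
      boolPair (boolPair ents (elemOf zs iu.length)) (boolPair nc t) := by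
  simp [matSetupDPFn, nthF, sndPow, fstF, sndF, elemFn_boolPair]

/-- **The matrix round**: `⟨iu, ⟨ku, acc⟩⟩ ↦ ⟨1 · iu, (ku, acc) after the row loop with
multiplier zs[|iu|]⟩`. [cite: KnuthTAOCP2, §4.6.4] -/
noncomputable def matBodyDP : List Bool → List Bool :=
  fanoutFn (List.cons true ∘ nthF 2) (sndPow 1 ∘ rowLoopDPFn ∘ matSetupDPFn)

/-- `matBodyDP ∈ FP`. [cite: AroraBarakCC2009, §1.3] -/
theorem matBodyDP_mem_FP : matBodyDP ∈ FP :=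
  fanoutFn_mem_FP (comp_mem_FP (cons_mem_FP true) (nthF_mem_FP 2))
    (comp_mem_FP (sndPow_mem_FP 1) (comp_mem_FP rowLoopDPFn_mem_FP matSetupDPFn_mem_FP))

/-- **Growth of a matrix round is polynomial in the fixed field, on every record.**
[folklore] -/
theorem length_matBodyDP_le (z : List Bool) :
    (matBodyDP z).length ≤ (sndPow 1 z).length + (2 * X + 8 + 126 * (X + 1) * (3 * X + 3)).eval (fstF z).length := by
  -- names: `x = fstF z = ⟨ents, ⟨zs, nc⟩⟩`, `sndPow 1 z = ⟨iu, t⟩`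
  have hiu : nthF 2 z = fstF (sndPow 1 z) := by simp [nthF, sndPow, fstF, sndF]
  have ht : sndPow 2 z = sndF (sndPow 1 z) := by simp [sndPow]
  have hst := length_fstF_sndF_le (sndPow 1 z)
  have hxsplit := length_fstF_sndF_le (fstF z)
  have hx1 := length_nthF_succ_add_sndPow_succ_le 0 (fstF z)
  simp only [sndPow_zero, Nat.zero_add] at hx1
  have hc : (elemOf (nthF 1 (fstF z)) (fstF (sndPow 1 z)).length).length ≤ (nthF 1 (fstF z)).length :=
    length_elemOf_le _ _
  -- the inner record `zin = ⟨xin, ⟨nc, t⟩⟩`, `xin = ⟨ents, c⟩`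
  have hsetup : matSetupDPFn z = boolPair (boolPair (fstF (fstF z)) (elemOf (nthF 1 (fstF z)) (fstF (sndPow 1 z)).length))
      (boolPair (sndPow 1 (fstF z)) (sndF (sndPow 1 z))) := by
    simp only [matSetupDPFn, fanoutFn_apply, Function.comp_apply, elemFn_boolPair, hiu, ht]
    rfl
  set xin := boolPair (fstF (fstF z)) (elemOf (nthF 1 (fstF z)) (fstF (sndPow 1 z)).length) with hxin
  set zin := boolPair xin (boolPair (sndPow 1 (fstF z)) (sndF (sndPow 1 z))) with hzin
  have hxinlen : xin.length ≤ 3 * (fstF z).length + 2 := by rw [hxin, length_boolPair]; omega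
  have hzinlen : zin.length = 2 * xin.length + 2 + (2 * (sndPow 1 (fstF z)).length + 2 + (sndF (sndPow 1 z)).length) := by
    simp only [hzin, length_boolPair]
  have hfz : fstF zin = xin := by simp [hzin, fstF]
  -- the row loop from the inner record: `m = |xin|` rounds
  have hrow : rowLoopDPFn zin = (loopStep rowBodyDP)^[xin.length] zin := by rw [rowLoopDPFn, hfz, eval_X]
  have hrlen := length_iterate_loopStep_rowBodyDP_le xin.length zin
  rw [hfz] at hrlen
  have hrfst : fstF ((loopStep rowBodyDP)^[xin.length] zin) = xin := by rw [fstF_iterate_loopStep, hfz]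
  have hrstruct := length_sndPow_one_add_le ((loopStep rowBodyDP)^[xin.length] zin)
  rw [hrfst] at hrstruct
  have hbody : matBodyDP z = boolPair (true :: fstF (sndPow 1 z)) (sndPow 1 ((loopStep rowBodyDP)^[xin.length] zin)) := by
    simp only [matBodyDP, fanoutFn_apply, Function.comp_apply, hsetup, hrow, hiu]
  rw [hbody, length_boolPair, List.length_cons]
  simp only [eval_add, eval_mul, eval_ofNat, eval_X, eval_one]
  have key : (sndPow 1 ((loopStep rowBodyDP)^[xin.length] zin)).length ≤
      (sndF (sndPow 1 z)).length + 2 * (sndPow 1 (fstF z)).length + 4 + xin.length * (42 * (xin.length + 1)) := by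
    omega
  have hm2 : xin.length * (42 * (xin.length + 1)) ≤ (3 * (fstF z).length + 2) * (42 * (3 * (fstF z).length + 3)) :=
    Nat.mul_le_mul hxinlen (Nat.mul_le_mul_left 42 (by omega))
  nlinarith [key, hm2, hst, hx1, hxsplit]

/-- **The matrix loop**: `|⟨ents, ⟨zs, nc⟩⟩|` rounds of `loopStep matBodyDP`. [cite: KnuthTAOCP2, §4.6.4] -/
noncomputable def matLoopDPFn (z : List Bool) : List Bool := (loopStep matBodyDP)^[X.eval (fstF z).length] z

/-- **`matLoopDPFn ∈ FP`**: a counted loop whose rounds (row loops) grow polynomially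
(`loopFn_mem_FP_of_poly`). [cite: AroraBarakCC2009, §1.3] -/
theorem matLoopDPFn_mem_FP : matLoopDPFn ∈ FP :=
  loopFn_mem_FP_of_poly matBodyDP_mem_FP (2 * X + 8 + 126 * (X + 1) * (3 * X + 3)) length_matBodyDP_le X

/-- The accumulator rows of the matrix loop: `acc₀ = 0ⁿ`, `accᵢ₊₁ = accᵢ + zs[i] · (row i)`,
as lists of strings. [cite: KnuthTAOCP2, §4.6.4] -/
noncomputable def matAccDP (ents zs : List Bool) (n : ℕ) : ℕ → List (List Bool)
  | 0 => List.replicate n []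
  | i + 1 => rowNewsDP ents (elemOf zs i) (i * n) (matAccDP ents zs n i) n

/-- `matAccDP` has `n` rows. [folklore] -/
@[simp] theorem length_matAccDP (ents zs : List Bool) (n : ℕ) : ∀ i, (matAccDP ents zs n i).length = n
  | 0 => by simp [matAccDP]
  | i + 1 => by simp [matAccDP]

/-- **Values of the accumulator**: `ival (accᵢ[j]) = ∑_{i' < i} ival zs[i'] · ival ents[i' n + j]`.
[cite: KnuthTAOCP2, §4.6.4] -/
theorem ival_matAccDP (ents zs : List Bool) (n : ℕ) {j : ℕ} (hj : j < n) : ∀ i : ℕ,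
    ival ((matAccDP ents zs n i).getD j []) =
      ∑ i' ∈ Finset.range i, ival (elemOf zs i') * ival (elemOf ents (i' * n + j))
  | 0 => by
    rw [matAccDP, List.getD_eq_getElem _ _ (by simpa using hj)]
    simp
  | i + 1 => by
    rw [matAccDP, ival_rowNewsDP _ _ _ _ _ _ hj, ival_matAccDP ents zs n hj i, Finset.sum_range_succ]

/-- The state map of the matrix loop for fixed `ents`, `zs`, `nc`. [folklore] -/
noncomputable def matStepDP (ents zs nc : List Bool) (s : List Bool) : List Bool :=
  boolPair (true :: fstP s) (sndPow 1 (rowLoopDPFn (boolPair (boolPair ents (elemOf zs (fstP s).length)) (boolPair nc (sndP s)))))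

/-- The matrix round on a record is the state map. [folklore] -/
theorem matBodyDP_apply (ents zs nc cnt s : List Bool) :
    matBodyDP (boolPair (boolPair ents (boolPair zs nc)) (boolPair cnt s)) = matStepDP ents zs nc s := by
  have h1 : matSetupDPFn (boolPair (boolPair ents (boolPair zs nc)) (boolPair cnt s)) =
      boolPair (boolPair ents (elemOf zs (fstP s).length)) (boolPair nc (sndP s)) := by
    simp only [matSetupDPFn, fanoutFn_apply, Function.comp_apply, elemFn_boolPair]
    simp [nthF, sndPow, fstF, sndF, fstP, sndP]
  have h2 : nthF 2 (boolPair (boolPair ents (boolPair zs nc)) (boolPair cnt s)) = fstP s := by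
    simp [nthF, fstF, sndF, fstP]
  unfold matBodyDP matStepDP
  rw [fanoutFn_apply]
  rw [Function.comp_apply, Function.comp_apply, Function.comp_apply]
  rw [h2]
  rw [h1]

/-- The matrix invariant: after `i ≤ n` rounds the state is `⟨1ⁱ, ⟨1ⁱⁿ, body accᵢ⟩⟩`.
[folklore] -/
theorem iterate_matStepDP (ents zs : List Bool) (n : ℕ) (hn : n ≤ ents.length) :
    ∀ i : ℕ, (matStepDP ents zs (encodeNat n))^[i] (boolPair [] (boolPair [] (body (List.replicate n [])))) =
      boolPair (List.replicate i true) (boolPair (List.replicate (i * n) true) (body (matAccDP ents zs n i)))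
  | 0 => by simp [matAccDP]
  | i + 1 => by
    rw [Function.iterate_succ_apply', iterate_matStepDP ents zs n hn i, matStepDP, fstP_boolPair, sndP_boolPair,
      List.length_replicate]
    have hlen : (matAccDP ents zs n i).length = n := length_matAccDP _ _ _ _
    have hspec := rowLoopDPFn_spec ents (elemOf zs i) (i * n) (matAccDP ents zs n i)
      (by rw [hlen, length_boolPair]; omega)
    rw [hlen] at hspec
    rw [hspec]
    have hproj : ∀ A B : List Bool, sndPow 1 (boolPair A (boolPair [] B)) = B := fun A B => by simp [sndPow, sndF]
    rw [hproj, Nat.succ_mul, List.replicate_succ]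
    rfl

/-- **Specification of the matrix loop**: from
`⟨⟨ents, ⟨zs, n⟩⟩, ⟨n, ⟨1⁰, ⟨1⁰, body 0ⁿ⟩⟩⟩⟩` with `n ≤ |ents|`, the loop ends with counter `0`
and the list code of `acc_n`, the vector `z B`. [cite: KnuthTAOCP2, §4.6.4] -/
theorem matLoopDPFn_spec (ents zs : List Bool) (n : ℕ) (hn : n ≤ ents.length) :
    matLoopDPFn (boolPair (boolPair ents (boolPair zs (encodeNat n)))
        (boolPair (encodeNat n) (boolPair [] (boolPair [] (body (List.replicate n [])))))) =
      boolPair (boolPair ents (boolPair zs (encodeNat n))) (boolPair []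
        (boolPair (List.replicate n true) (boolPair (List.replicate (n * n) true) (body (matAccDP ents zs n n))))) := by
  have hx : fstF (boolPair (boolPair ents (boolPair zs (encodeNat n)))
      (boolPair (encodeNat n) (boolPair [] (boolPair [] (body (List.replicate n [])))))) =
      boolPair ents (boolPair zs (encodeNat n)) := by simp [fstF]
  have hrounds : n ≤ X.eval (boolPair ents (boolPair zs (encodeNat n))).length := by
    rw [eval_X, length_boolPair]; omega
  rw [matLoopDPFn, hx, iterate_loopStep matBodyDP _ n _ _ hrounds,
    loopModel_eq_iterate (g := matStepDP ents zs (encodeNat n)) (fun cnt s => matBodyDP_apply ents zs _ cnt s),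
    iterate_matStepDP ents zs n hn n]


end Brick

end Literature.Computability.Complexity
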